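import Literature.Computability.QuantumComplexity.PromiseClassesRel
import Literature.Computability.QuantumComplexity.CountingSimulationRelProofs
import Literature.Computability.QuantumComplexity.AaronsonAmbainisThm23
import Literature.Computability.QuantumComplexity.AaronsonAmbainisThm23Queries
import Literature.Computability.Complexity.PromiseBPPRelAlmostP
import Literature.Computability.Complexity.PromiseZPPProofs
import Literature.Barriers.QuantumAdvantage.FFKLSegments
import Summits.QuantumAdvantage.QuantumAdvantage.Statement
import HarnessLib

/-!
# A witness against the quantum door at measure one is one uniform family, thick on both sides

Solo seat `solo-QuantumAdvantage-informed`, session 9, file 27. The one cell of the door table left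
open by files 19–23 is the quantum door relative to a RANDOM oracle,

  `Q-R :  ∀ᵐ A, Q-EXT^A`,  `Q-EXT^A := PromiseBQP^A ⊆ promiseLift BQP^A`

(every promise-`BQP^A` problem is solved by some `BQP^A` LANGUAGE). This file types what a
refutation of `Q-R` must produce, and removes the "thin" regime from the search space.

1. `ae_promiseSep_of_not_QEXTRel`, `not_ae_promiseSubset_of_not_ae_QEXTRel`: since the classical
   floor holds a.e. (Bennett–Gill in promise form, Literature `promiseBPP'Rel_subset_promiseLift_PRel_ae`),
   refuting `Q-R` proves the random-oracle PROMISE separation `PromiseBQP^A ⊄ PromiseBPP'^A` on a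
   non-null set of oracles — a statement not known today (Aaronson–Ambainis: under their Conjecture,
   "we basically cannot hope to prove P ≠ BQP relative to a random oracle"; Yamakawa–Zhandry separate
   SEARCH problems and note that decision problems are exactly where the conjecture bites).
2. `gapProblem F A = ({x | p_x(A) ≥ 2/3}, {x | p_x(A) ≤ 1/3})`, the canonical promise problem of a
   circuit family at the oracle `A`; every `PromiseBQP^A` problem is a sub-problem of the gap problem
   of a UNIFORM family (`exists_gapProblem_of_mem`), and the uniform families are countable, so
   `Q-R ↔ ∀ uniform F, ∀ᵐ A, gapProblem F A ∈ promiseLift BQP^A` (`ae_QEXTRel_iff_forall_gapProblem`):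
   a refutation of `Q-R` is ONE uniform oracle family whose gap problem has no `BQP^A`-language
   solution on a non-null set (`exists_witness_of_not_ae_QEXTRel`).
3. THIN SIDES LIFT (Borel–Cantelli I). The yes-mass of `F` at `x` is the explicit dyadic rational
   `μ {A | p_x(A) ≥ 2/3} = #{b ∈ {0,1}^M | p̂_x(b) ≥ 2/3} · 2^{-M}` (`measure_yesEvent_eq`, via the
   acceptance polynomial over the `M = 2^{width} − 1` relevant oracle bits, Literature
   `evalBool_acceptPoly`). If `Σ_x μ {A | p_x(A) ≥ 2/3} < ∞` then a.s. the yes side is FINITE and the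
   finite language `yes` itself (in `P ⊆ P^A`) solves the gap problem; symmetrically for the no side
   with the cofinite language `noᶜ` (`ae_gapProblem_mem_promiseLift_of_thin_yes/_no`). Hence
   (`witness_thick`) a witness against `Q-R` has BOTH mass series divergent — both sides a.s. meet
   infinitely many inputs — and (`witness_not_ae_PromiseBPP'Rel`) its gap problem is not a.e. in
   `PromiseBPP'^A`: it is a THICK random-oracle promise separation between quantum and classical
   polynomial time. Every "structured" exponential speed-up (period, hidden shift, Forrelation value
   planted in a random block of `K` bits) has yes-mass `2^{-Ω(K)}` with `K` super-polynomial, i.e. is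
   thin; the Aaronson–Ben-David relations `R = O(Q² · (1 + min{log|f⁻¹(0)|, log|f⁻¹(1)|}))` and
   `D = O(Q² log²|Dom f|)` constrain the opposite (small-side / small-domain) regimes only, so the thick
   regime is constrained by no theorem in print. NB the Aaronson–Ambainis conjecture (classical
   `poly(T, 1/ε, 1/δ)`-query simulation off a `δ`-fraction of oracles, per input) does NOT exclude it
   either: finitely many failures over the `2ⁿ` inputs of each length need per-input failure `δ ≈ 4^{-n}`,
   i.e. exponential cost; only a `poly(T, 1/ε, log(1/δ))` strengthening of the conjecture would
   (prose; recorded as the typed open question of the seat's paper §4.23).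

## References
* [BennettGill1981] C. H. Bennett, J. Gill, SIAM J. Comput. 10 (1981), Thm. 5.
* [AaronsonAmbainis2014] S. Aaronson, A. Ambainis, *The need for structure in quantum speedups*,
  Theory Comput. 10 (2014), Conj. 4 / Thm. 23 and p. 5 [corpus: paper:arxiv-0911.0996 p.5, p.14].
* [YamakawaZhandry2022] T. Yamakawa, M. Zhandry, *Verifiable quantum advantage without structure*,
  FOCS 2022, Conj. 1.1 and the paragraph before Thm. 1.5 [corpus: paper:arxiv-2204.02063 p.3–4].
* [AaronsonBenDavid2016] S. Aaronson, S. Ben-David, *Sculpting quantum speedups*, CCC 2016,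
  Thm. 3 (`bal`) and the small-promise theorem [corpus: paper:arxiv-1512.04016 p.3–4].
* [Goldreich2006] O. Goldreich, *On promise problems: a survey*, LNCS 3895 (2006), Def. 1.2.
-/

noncomputable section

namespace Summit.QuantumAdvantage.QuantumAdvantage.Theorems

open _root_.MeasureTheory _root_.Filter _root_.Computability Literature.Computability.Complexity
  Literature.Computability.Complexity.Classes Literature.Computability.Cryptography
  Literature.Computability.QuantumComplexity Literature.Barriers.QuantumAdvantage
open scoped ENNReal

/-! ### 1. Refuting the door at measure one proves a random-oracle promise separation -/

/-- **Pointwise a.e.: where the quantum door fails, `PromiseBQP^A ⊄ PromiseBPP'^A`.** The classical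
floor `PromiseBPP'^A ⊆ promiseLift P^A ⊆ promiseLift BQP^A` holds for almost every `A`
(Bennett–Gill in promise form), so on almost every oracle `¬ Q-EXT^A` forces a promise problem of
`PromiseBQP^A` outside `PromiseBPP'^A`. [cite: BennettGill1981, Thm. 5] [cite: Goldreich2006, Def. 1.2] -/
theorem ae_promiseSep_of_not_QEXTRel :
    ∀ᵐ A : Set (List Bool) ∂randomOracleMeasure,
      ¬ PromiseBQPRel A ⊆ promiseLift (BQPRel A) →
        ¬ PromiseBQPRel A ⊆ PromiseBPP'Rel (Oracle.ofLanguage A) := by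
  filter_upwards [promiseBPP'Rel_subset_promiseLift_PRel_ae] with A hA hno hsub
  exact hno (hsub.trans (hA.trans (promiseLift_mono (PRel_ofLanguage_subset_BQPRel_holds A))))

/-- **Refuting `Q-R` proves a random-oracle promise separation**: if `Q-EXT^A` fails on a non-null
set of oracles then so does `PromiseBQP^A ⊆ PromiseBPP'^A` — which is not known (Aaronson–Ambainis:
under their conjecture one "basically cannot hope to prove `P ≠ BQP` relative to a random oracle").
[cite: AaronsonAmbainis2014, p. 5 and Thm. 23] [cite: BennettGill1981, Thm. 5] -/
theorem not_ae_promiseSubset_of_not_ae_QEXTRel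
    (h : ¬ ∀ᵐ A : Set (List Bool) ∂randomOracleMeasure, PromiseBQPRel A ⊆ promiseLift (BQPRel A)) :
    ¬ ∀ᵐ A : Set (List Bool) ∂randomOracleMeasure,
      PromiseBQPRel A ⊆ PromiseBPP'Rel (Oracle.ofLanguage A) := by
  intro hall
  refine h ?_
  filter_upwards [hall, ae_promiseSep_of_not_QEXTRel] with A h1 h2
  by_contra hno
  exact h2 hno h1

/-! ### 2. The canonical gap problem of a family; one uniform family suffices -/

/-- **The gap problem of a circuit family `F` at the oracle `A`**: yes-instances `p_x(A) ≥ 2/3`,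
no-instances `p_x(A) ≤ 1/3` (the largest promise on which `F` is a bounded-error decider).
[cite: Goldreich2006, Def. 1.2] -/
def gapProblem (F : QCircuitFamily cliffordT) (A : Set (List Bool)) : PromiseProblem :=
  ⟨(({x : List Bool | 2 / 3 ≤ F.acceptProbOn A x} : Set (List Bool)) : Language Bool),
    (({x : List Bool | F.acceptProbOn A x ≤ 1 / 3} : Set (List Bool)) : Language Bool)⟩

/-- Unfolding: `x` is a yes-instance of the gap problem iff `p_x(A) ≥ 2/3`. [folklore] -/
theorem mem_gapProblem_yes {F : QCircuitFamily cliffordT} {A : Set (List Bool)} {x : List Bool} :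
    x ∈ (gapProblem F A).yes ↔ 2 / 3 ≤ F.acceptProbOn A x := Iff.rfl

/-- Unfolding: `x` is a no-instance of the gap problem iff `p_x(A) ≤ 1/3`. [folklore] -/
theorem mem_gapProblem_no {F : QCircuitFamily cliffordT} {A : Set (List Bool)} {x : List Bool} :
    x ∈ (gapProblem F A).no ↔ F.acceptProbOn A x ≤ 1 / 3 := Iff.rfl

/-- The gap problem is a (disjoint) promise problem. [cite: Goldreich2006, Def. 1.1] -/
theorem gapProblem_disjoint (F : QCircuitFamily cliffordT) (A : Set (List Bool)) :
    (gapProblem F A).Disjoint := by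
  change _root_.Disjoint ({x : List Bool | 2 / 3 ≤ F.acceptProbOn A x} : Set (List Bool))
    ({x : List Bool | F.acceptProbOn A x ≤ 1 / 3} : Set (List Bool))
  rw [Set.disjoint_left]
  intro x hy hn
  simp only [Set.mem_setOf_eq] at hy hn
  linarith

/-- The gap problem of a UNIFORM family at `A` is in `PromiseBQP^A`. [cite: Watrous2009, §III.2] -/
theorem gapProblem_mem_PromiseBQPRel {F : QCircuitFamily cliffordT} (hF : F.IsUniform)
    (A : Set (List Bool)) : gapProblem F A ∈ PromiseBQPRel A :=
  ⟨F, hF, fun _ hx => mem_gapProblem_yes.1 hx, fun _ hx => mem_gapProblem_no.1 hx⟩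

/-- Every `PromiseBQP^A` problem is a sub-problem of the gap problem of a uniform family.
[cite: Watrous2009, §III.2] -/
theorem exists_gapProblem_of_mem {A : Set (List Bool)} {Q : PromiseProblem} (hQ : Q ∈ PromiseBQPRel A) :
    ∃ F : QCircuitFamily cliffordT, F.IsUniform ∧ Q.yes ≤ (gapProblem F A).yes ∧ Q.no ≤ (gapProblem F A).no := by
  obtain ⟨F, hF, hy, hn⟩ := hQ
  exact ⟨F, hF, fun x hx => mem_gapProblem_yes.2 (hy x hx), fun x hx => mem_gapProblem_no.2 (hn x hx)⟩

/-- `Q-EXT^A` at one oracle, read on gap problems: it holds iff the gap problem of every uniform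
family has a `BQP^A`-language solution. [cite: Goldreich2006, Def. 1.2] -/
theorem QEXTRel_iff_forall_gapProblem (A : Set (List Bool)) :
    PromiseBQPRel A ⊆ promiseLift (BQPRel A) ↔
      ∀ F : QCircuitFamily cliffordT, F.IsUniform → gapProblem F A ∈ promiseLift (BQPRel A) := by
  constructor
  · exact fun h F hF => h (gapProblem_mem_PromiseBQPRel hF A)
  · intro h Q hQ
    obtain ⟨F, hF, hy, hn⟩ := exists_gapProblem_of_mem hQ
    exact promiseLift_anti hy hn (h F hF)

/-- **`Q-R` is a countable conjunction**: the uniform Clifford+T families are countable (Literature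
`countable_setOf_isUniform`), so `Q-EXT` holds relative to a random oracle iff for EVERY uniform
family separately the gap problem has a `BQP^A`-language solution almost surely.
[cite: AaronsonAmbainis2014, proof of Thm. 23 (p. 14)] -/
theorem ae_QEXTRel_iff_forall_gapProblem :
    (∀ᵐ A : Set (List Bool) ∂randomOracleMeasure, PromiseBQPRel A ⊆ promiseLift (BQPRel A)) ↔
      ∀ F : QCircuitFamily cliffordT, F.IsUniform →
        ∀ᵐ A : Set (List Bool) ∂randomOracleMeasure, gapProblem F A ∈ promiseLift (BQPRel A) := by
  have hc : Set.Countable {F : QCircuitFamily cliffordT | F.IsUniform} := countable_setOf_isUniform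
  constructor
  · intro h F hF
    filter_upwards [h] with A hA
    exact (QEXTRel_iff_forall_gapProblem A).1 hA F hF
  · intro h
    have h' : ∀ᵐ A : Set (List Bool) ∂randomOracleMeasure,
        ∀ F ∈ {F : QCircuitFamily cliffordT | F.IsUniform}, gapProblem F A ∈ promiseLift (BQPRel A) :=
      (ae_ball_iff hc).2 fun F hF => h F hF
    filter_upwards [h'] with A hA
    exact (QEXTRel_iff_forall_gapProblem A).2 fun F hF => hA F hF

/-- **A refutation of `Q-R` is one uniform family**: if the quantum door fails on a non-null set of
oracles, some single uniform oracle family has a gap problem without `BQP^A`-language solution on a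
non-null set. [cite: AaronsonAmbainis2014, proof of Thm. 23 (p. 14)] -/
theorem exists_witness_of_not_ae_QEXTRel
    (h : ¬ ∀ᵐ A : Set (List Bool) ∂randomOracleMeasure, PromiseBQPRel A ⊆ promiseLift (BQPRel A)) :
    ∃ F : QCircuitFamily cliffordT, F.IsUniform ∧
      ¬ ∀ᵐ A : Set (List Bool) ∂randomOracleMeasure, gapProblem F A ∈ promiseLift (BQPRel A) := by
  by_contra hno
  exact h (ae_QEXTRel_iff_forall_gapProblem.2 fun F hF => by
    by_contra hc
    exact hno ⟨F, hF, hc⟩)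

/-! ### 3. Thin sides lift (Borel–Cantelli I) -/

/-- **Borel–Cantelli for input-indexed oracle events**: if `Σ_x μ(E x) < ∞` then almost every oracle
lies in `E x` for only finitely many inputs `x`. [cite: BennettGill1981, Lemma 1 (Borel–Cantelli step)] -/
theorem ae_finite_setOf_mem (E : List Bool → Set (Set (List Bool)))
    (h : ∑' x, randomOracleMeasure (E x) ≠ ∞) :
    ∀ᵐ A : Set (List Bool) ∂randomOracleMeasure, Set.Finite {x : List Bool | A ∈ E x} := by
  have h0 : randomOracleMeasure (limsup E cofinite) = 0 := measure_limsup_cofinite_eq_zero h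
  filter_upwards [compl_mem_ae_iff.2 h0] with A hA
  rw [Filter.cofinite.limsup_set_eq] at hA
  simpa only [Set.mem_compl_iff, Set.mem_setOf_eq, Set.not_infinite] using hA

/-- A disjoint promise problem with FINITE yes side is solved by the finite language `yes ∈ P`.
[cite: Goldreich2006, Def. 1.2] -/
theorem mem_promiseLift_P_of_yes_finite {Q : PromiseProblem} (hQ : Q.Disjoint)
    (hfin : Set.Finite (Q.yes : Set (List Bool))) : Q ∈ promiseLift Classes.P :=
  ⟨Q.yes, FFKL.mem_P_of_finite hfin, le_rfl, hQ.le_compl_left⟩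

/-- A disjoint promise problem with FINITE no side is solved by the cofinite language `noᶜ ∈ P`.
[cite: Goldreich2006, Def. 1.2] -/
theorem mem_promiseLift_P_of_no_finite {Q : PromiseProblem} (hQ : Q.Disjoint)
    (hfin : Set.Finite (Q.no : Set (List Bool))) : Q ∈ promiseLift Classes.P :=
  ⟨Q.noᶜ, compl_mem_P_iff.2 (FFKL.mem_P_of_finite hfin), hQ.le_compl_right, (compl_compl Q.no).symm.le⟩

/-- **Thin yes side ⇒ solved in `P^A` almost surely.** For any oracle-indexed family of disjoint
promise problems: if the yes-masses `μ {A | x ∈ yes(A)}` are summable over the inputs `x`, then for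
almost every `A` the problem at `A` has a `P^A`-language solution (indeed a finite one).
[cite: BennettGill1981, Lemma 1 (Borel–Cantelli step)] [cite: Goldreich2006, Def. 1.2] -/
theorem ae_mem_promiseLift_PRel_of_thin_yes (Φ : Set (List Bool) → PromiseProblem)
    (hdisj : ∀ A, (Φ A).Disjoint)
    (h : ∑' x : List Bool, randomOracleMeasure {A | x ∈ (Φ A).yes} ≠ ∞) :
    ∀ᵐ A : Set (List Bool) ∂randomOracleMeasure, Φ A ∈ promiseLift (PRel (Oracle.ofLanguage A)) := by
  filter_upwards [ae_finite_setOf_mem (fun x => {A | x ∈ (Φ A).yes}) h] with A hA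
  refine promiseLift_mono (P_subset_PRel_holds _) (mem_promiseLift_P_of_yes_finite (hdisj A) ?_)
  exact hA.subset fun x hx => hx

/-- **Thin no side ⇒ solved in `P^A` almost surely** (symmetric). [cite: BennettGill1981, Lemma 1 (Borel–Cantelli step)] [cite: Goldreich2006, Def. 1.2] -/
theorem ae_mem_promiseLift_PRel_of_thin_no (Φ : Set (List Bool) → PromiseProblem)
    (hdisj : ∀ A, (Φ A).Disjoint)
    (h : ∑' x : List Bool, randomOracleMeasure {A | x ∈ (Φ A).no} ≠ ∞) :
    ∀ᵐ A : Set (List Bool) ∂randomOracleMeasure, Φ A ∈ promiseLift (PRel (Oracle.ofLanguage A)) := by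
  filter_upwards [ae_finite_setOf_mem (fun x => {A | x ∈ (Φ A).no}) h] with A hA
  refine promiseLift_mono (P_subset_PRel_holds _) (mem_promiseLift_P_of_no_finite (hdisj A) ?_)
  exact hA.subset fun x hx => hx

/-! ### 4. The masses of a circuit family are explicit; a witness is thick on both sides -/

section Mass

variable (F : QCircuitFamily cliffordT) (x : List Bool)

/-- The bit patterns of the `M` relevant oracle bits on which `F` accepts `x` with probability `≥ 2/3`.
[cite: AaronsonAmbainis2014, Lemma 20] -/
def yesPatterns : Finset (Fin (numOracleBits F x) → Bool) :=
  Finset.univ.filter fun b => 2 / 3 ≤ evalBool (acceptPoly F x) b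

/-- The bit patterns on which `F` accepts `x` with probability `≤ 1/3`. [cite: AaronsonAmbainis2014, Lemma 20] -/
def noPatterns : Finset (Fin (numOracleBits F x) → Bool) :=
  Finset.univ.filter fun b => evalBool (acceptPoly F x) b ≤ 1 / 3

/-- **The yes-mass is an explicit dyadic rational**: `μ {A | p_x(A) ≥ 2/3} = #yesPatterns · 2^{-M}`.
[cite: AaronsonAmbainis2014, Lemma 20 and proof of Thm. 23] [cite: BookVollmerWagner1996, §3 (p. 373)] -/
theorem measure_yesEvent_eq :
    randomOracleMeasure {A : Set (List Bool) | x ∈ (gapProblem F A).yes} =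
      (yesPatterns F x).card * 2⁻¹ ^ numOracleBits F x := by
  rw [← randomOracleMeasure_oracleBits_mem F x (yesPatterns F x)]
  congr 1
  ext A
  simp only [Set.mem_setOf_eq, mem_gapProblem_yes, yesPatterns, Finset.mem_filter, Finset.mem_univ,
    true_and, evalBool_acceptPoly]

/-- **The no-mass**: `μ {A | p_x(A) ≤ 1/3} = #noPatterns · 2^{-M}`. [cite: AaronsonAmbainis2014, Lemma 20 and proof of Thm. 23] [cite: BookVollmerWagner1996, §3 (p. 373)] -/
theorem measure_noEvent_eq :
    randomOracleMeasure {A : Set (List Bool) | x ∈ (gapProblem F A).no} =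
      (noPatterns F x).card * 2⁻¹ ^ numOracleBits F x := by
  rw [← randomOracleMeasure_oracleBits_mem F x (noPatterns F x)]
  congr 1
  ext A
  simp only [Set.mem_setOf_eq, mem_gapProblem_no, noPatterns, Finset.mem_filter, Finset.mem_univ,
    true_and, evalBool_acceptPoly]

end Mass

/-- **Thin yes-mass ⇒ the gap problem lifts to `P^A` a.s.** (hence to every rung of the door).
[cite: BennettGill1981, Lemma 1 (Borel–Cantelli step)] -/
theorem ae_gapProblem_mem_promiseLift_of_thin_yes (F : QCircuitFamily cliffordT)
    (h : ∑' x : List Bool, ((yesPatterns F x).card : ℝ≥0∞) * 2⁻¹ ^ numOracleBits F x ≠ ∞) :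
    ∀ᵐ A : Set (List Bool) ∂randomOracleMeasure,
      gapProblem F A ∈ promiseLift (PRel (Oracle.ofLanguage A)) := by
  refine ae_mem_promiseLift_PRel_of_thin_yes (gapProblem F) (gapProblem_disjoint F) ?_
  simpa only [measure_yesEvent_eq] using h

/-- **Thin no-mass ⇒ the gap problem lifts to `P^A` a.s.** [cite: BennettGill1981, Lemma 1 (Borel–Cantelli step)] -/
theorem ae_gapProblem_mem_promiseLift_of_thin_no (F : QCircuitFamily cliffordT)
    (h : ∑' x : List Bool, ((noPatterns F x).card : ℝ≥0∞) * 2⁻¹ ^ numOracleBits F x ≠ ∞) :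
    ∀ᵐ A : Set (List Bool) ∂randomOracleMeasure,
      gapProblem F A ∈ promiseLift (PRel (Oracle.ofLanguage A)) := by
  refine ae_mem_promiseLift_PRel_of_thin_no (gapProblem F) (gapProblem_disjoint F) ?_
  simpa only [measure_noEvent_eq] using h

/-- **A witness against `Q-R` is thick on both sides**: if the gap problem of `F` has no
`BQP^A`-language solution on a non-null set of oracles, then both mass series diverge — both sides of
the promise almost surely meet infinitely many inputs. (Every planted-structure promise — period,
hidden shift, Forrelation value in a random block of `K` bits, `K` super-polynomial — is thin.)
[cite: BennettGill1981, Lemma 1 (Borel–Cantelli step)] [cite: AaronsonBenDavid2016, Thm. 3] -/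
theorem witness_thick (F : QCircuitFamily cliffordT)
    (h : ¬ ∀ᵐ A : Set (List Bool) ∂randomOracleMeasure, gapProblem F A ∈ promiseLift (BQPRel A)) :
    (∑' x : List Bool, ((yesPatterns F x).card : ℝ≥0∞) * 2⁻¹ ^ numOracleBits F x = ∞) ∧
      ∑' x : List Bool, ((noPatterns F x).card : ℝ≥0∞) * 2⁻¹ ^ numOracleBits F x = ∞ := by
  have lift : ∀ {A : Set (List Bool)}, gapProblem F A ∈ promiseLift (PRel (Oracle.ofLanguage A)) →
      gapProblem F A ∈ promiseLift (BQPRel A) :=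
    fun {A} hA => promiseLift_mono (PRel_ofLanguage_subset_BQPRel_holds A) hA
  constructor
  · by_contra hne
    refine h ?_
    filter_upwards [ae_gapProblem_mem_promiseLift_of_thin_yes F hne] with A hA
    exact lift hA
  · by_contra hne
    refine h ?_
    filter_upwards [ae_gapProblem_mem_promiseLift_of_thin_no F hne] with A hA
    exact lift hA

/-- **… and it is a random-oracle promise separation**: the gap problem of a witness family is NOT
in `PromiseBPP'^A` almost surely (else Bennett–Gill would lift it into `promiseLift P^A ⊆
promiseLift BQP^A` a.s.). [cite: BennettGill1981, Thm. 5] -/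
theorem witness_not_ae_PromiseBPP'Rel (F : QCircuitFamily cliffordT)
    (h : ¬ ∀ᵐ A : Set (List Bool) ∂randomOracleMeasure, gapProblem F A ∈ promiseLift (BQPRel A)) :
    ¬ ∀ᵐ A : Set (List Bool) ∂randomOracleMeasure,
      gapProblem F A ∈ PromiseBPP'Rel (Oracle.ofLanguage A) := by
  intro hall
  refine h ?_
  filter_upwards [hall, promiseBPP'Rel_subset_promiseLift_PRel_ae] with A h1 h2
  exact promiseLift_mono (PRel_ofLanguage_subset_BQPRel_holds A) (h2 h1)

/-- **Summary (the shape of a refutation of `Q-R`).** If the quantum door fails relative to a random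
oracle (on a non-null set), then there is ONE uniform Clifford+T oracle family `F` such that
(i) its gap problem has no `BQP^A`-language solution on a non-null set, (ii) both of its mass series
diverge (thick on both sides), and (iii) its gap problem lies outside `PromiseBPP'^A` on a non-null
set — a thick random-oracle promise separation of quantum from classical polynomial time, constrained
by no published theorem (and not by the Aaronson–Ambainis conjecture, whose `poly(1/δ)` cost cannot beat
the union over `2ⁿ` inputs; only a `log(1/δ)` strengthening would exclude it).
[cite: AaronsonAmbainis2014, Conj. 4 and Thm. 23] [cite: YamakawaZhandry2022, Conj. 1.1] [cite: BennettGill1981, Thm. 5] -/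
theorem shape_of_not_ae_QEXTRel
    (h : ¬ ∀ᵐ A : Set (List Bool) ∂randomOracleMeasure, PromiseBQPRel A ⊆ promiseLift (BQPRel A)) :
    ∃ F : QCircuitFamily cliffordT, F.IsUniform ∧
      (¬ ∀ᵐ A : Set (List Bool) ∂randomOracleMeasure, gapProblem F A ∈ promiseLift (BQPRel A)) ∧
      (∑' x : List Bool, ((yesPatterns F x).card : ℝ≥0∞) * 2⁻¹ ^ numOracleBits F x = ∞) ∧
      (∑' x : List Bool, ((noPatterns F x).card : ℝ≥0∞) * 2⁻¹ ^ numOracleBits F x = ∞) ∧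
      ¬ ∀ᵐ A : Set (List Bool) ∂randomOracleMeasure,
        gapProblem F A ∈ PromiseBPP'Rel (Oracle.ofLanguage A) := by
  obtain ⟨F, hF, hW⟩ := exists_witness_of_not_ae_QEXTRel h
  exact ⟨F, hF, hW, (witness_thick F hW).1, (witness_thick F hW).2, witness_not_ae_PromiseBPP'Rel F hW⟩

end Summit.QuantumAdvantage.QuantumAdvantage.Theorems

end
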